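import Summits.HodgeConjecture.HodgeConjecture.Theorems.R90S5ScPartnerUniqueSigned          -- ★ (this seat, p861393) `eq_of_charIdentityAtTestSigned`: the supercuspidal partner in the SIGNED [13.1.4] is unique
import Summits.HodgeConjecture.HodgeConjecture.Theorems.F0P3cDbTEnvelopeTrichotomy         -- ★ brings `MemXiFamily`, `CMCharIdentityPackageTestSigned`, (H₇), `xiLocalChar` (the sockets' cone, as in S9 file A ∕ S5 file D)
import Literature.NumberTheory.Rogawski1990.CharIdentityOnTestFunctionsSignedLemmas        -- ★ `CMNonsplitCharIdentityAtTestSigned.πs` ∕ `.charIdentityAtTestSigned_πs`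
import Literature.NumberTheory.Rogawski1990.FinExplicitTransferFactorConjLeft              -- ★ print's `Δ‴`: `finExplicitCollection`, `finExplicitDelta_conj_left_all`
import Literature.NumberTheory.Rogawski1990.FinExplicitTransferFactorConjRight             -- ★ `finExplicitDelta_conj_right_all`
import Literature.NumberTheory.Automorphic.OrbitalMeasureCanonical                         -- ★ `OrbitalMeasureFamily.IsCanonical`, `IsLocalGRegular`, `IsRegularElt`
import HarnessLib

/-!
# R90-TF · S5 → S9 ∕ LH10 — for EVERY inner form `U(H)`: the leaf letter (O2♮) `StubXiPacketRigidCoreSc` IMPLIES S9's (S-U) `SocketScUnique`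
# (the converse of S9 A ★ `xiPacketRigidCoreSc_of_scUnique`; so O2♮ ⟺ (S-U) ⟺ (S-G) over ★ and the index's R5 ∕ R5′ are equivalences)

Cell `hodgecm-mathlib`, crux H413 (`stmt-HodgeConjecture-24833`), route of record `HCCMUnconditional`; programme R90-TF (brief `director/R90-BRIEF.v2.md`
1f40d54518340a35), section S5 = Ch. 13.3 (base `R90-C133`), seat R90-C133-p01 (g0), socket S5#4 ROAD α (finding (F3) of the seat's REPORT-FIRST on the R90 bus:
the uniqueness pin that (S-U)-type sockets add over (β)-type letters is ★, for every `H`).  Lane `--supports stmt-HodgeConjecture-24833 --as helper`; ONE theorem, no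
definition, no instance, no notation, no `sorry`; Lines-free, so both sides BY NAME-SHAPE: the hypothesis `Hβ` is the body of `F0P3cDbTPaydown.StubXiPacketRigidCoreSc`
(`Lines/F0_P3c_DbTPaydown.lean` :342–:415; = S9's `TopXiPacketRigidCoreSc`, certified `o2natural_of_S9_top` in `Lines/R90_TF_Index.lean`) TOKEN FOR TOKEN, the conclusion
is the body of `R90.S9.SocketScUnique` (`Lines/R90_S9_InnerFormXiRigiditySockets.lean` :157–:226, ED. 1 4ec8b02abbbf79d1) TOKEN FOR TOKEN.  Index adapter (architect's pen):
`theorem scUnique_of_o2natural (h : F0P3cDbTPaydown.StubXiPacketRigidCoreSc) : R90.S9.SocketScUnique := R90.S5.scUnique_of_rigidCoreSc h`.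
HONEST LABEL: HC_CM is proved only modulo the 7 printed citations (2 remaining named inputs: hLiu418 = stmt-HodgeConjecture-24832, h413 = stmt-HodgeConjecture-24833)
until rung 0 closes; this file proves NO printed global statement — it proves the implication (β) ⟹ (S-U) for all inner forms (print: Prop. 13.1.3 (d)'s `πˢ(ξ_v)` is
THE partner; «uniqueness … follows from linear independence of characters», §13.8 p. 229).

THE PROOF.  As in `qsScUnique_of_rigidCoreScQs` (the `H := Φ₃` instance): `hId := (hQS ξ).1 v hns T a ha h μZ π2 πn hK hn` is the signed letter at `ε_v = ±1 ≠ 0`,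
`hId.πs` completes `πⁿ ∘ e` (★ `charIdentityAtTestSigned_πs`), `Hβ` says `c` does, transfer exists at `v` (`hex`), so `c = hId.πs` (★ `eq_of_charIdentityAtTestSigned`).

[cite: Rogawski1990, §13.3 Thm. 13.3.5 p. 202, Thm. 13.3.6 (c) p. 202; §14.6 Thm. 14.6.1 p. 241, Thm. 14.6.4 p. 243; §13.1 Prop. 13.1.3 (d), Prop. 13.1.4 p. 199; §13.8 Prop. 13.8.1 p. 213, p. 229; §4.9 p. 55]
[cite: LanglandsShelstad1987, §1]
-/

set_option autoImplicit false
-- the mandated namespace repeats the single-problem summit's segment (`HodgeConjecture.HodgeConjecture`)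
set_option linter.dupNamespace false

noncomputable section

open NumberField IsDedekindDomain MeasureTheory
open scoped Matrix ComplexOrder

open Literature.NumberTheory Literature.NumberTheory.Automorphic Literature.NumberTheory.Automorphic.UnitaryGroup
open Literature.NumberTheory.Automorphic.IdeleClassGroup
open Literature.NumberTheory.GaloisRepresentations
open Literature.NumberTheory.Rogawski1990
open Summit.HodgeConjecture.HodgeConjecture.Cruxes.H413

namespace Summit.HodgeConjecture.HodgeConjecture.R90.S5

set_option synthInstance.maxHeartbeats 400000 in
set_option maxHeartbeats 8000000 in
open scoped Classical in
/-- **`(β) ⟹ (S-U)` FOR EVERY INNER FORM `U(H)`**: if every SUPERCUSPIDAL `v`-constituent `c` of a discrete `P` of `U(H)` with `MemXiFamily P … ξ` completes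
`πⁿ(ξ_v) ∘ e` in the SIGNED [13.1.4] on test functions at print's pinned data (`Hβ` = the body of the LH10 leaf letter `StubXiPacketRigidCoreSc`, token for token),
then every such `c` IS `((hQS ξ).1 v …).πs` (the body of `R90.S9.SocketScUnique`, token for token).  Converse of S9 A's ★ `xiPacketRigidCoreSc_of_scUnique`.
Proof: uniqueness of the partner (★ `eq_of_charIdentityAtTestSigned`; transfer existence = the binder `hex`; `ε_v = ±1 ≠ 0`) against ★ `charIdentityAtTestSigned_πs`.
[cite: Rogawski1990, §13.1 Prop. 13.1.3 (d), Prop. 13.1.4 p. 199; §13.8 p. 229; §13.3 Thm. 13.3.6 (c) p. 202; §14.6 Thm. 14.6.4 p. 243] -/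
theorem scUnique_of_rigidCoreSc
    (Hβ :
      ∀ (L : Type) [Field L] [NumberField L] [IsCMField L] (H : Matrix (Fin 3) (Fin 3) L)
        (hH : (H.map (cmConjRingHom L))ᵀ = H) (hHd : IsUnit H.det)
        [∀ v : HeightOneSpectrum (𝓞 ↥(maximalRealSubfield L)), MeasurableSpace ((cmDatum L 3 H).Local v)]
        [∀ v : HeightOneSpectrum (𝓞 ↥(maximalRealSubfield L)),
          MeasurableSpace ((cmDatum L 2 (Matrix.of fun i j : Fin 2 => if i.val + j.val + 1 = 2 then (1 : L) else 0)).Local v ×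
            (cmDatum L 1 (Matrix.of fun i j : Fin 1 => if i.val + j.val + 1 = 1 then (1 : L) else 0)).Local v)]
        [∀ (v : HeightOneSpectrum (𝓞 ↥(maximalRealSubfield L)))
            (a : ((cmDatum L 2 (Matrix.of fun i j : Fin 2 => if i.val + j.val + 1 = 2 then (1 : L) else 0)).Local v ×
              (cmDatum L 1 (Matrix.of fun i j : Fin 1 => if i.val + j.val + 1 = 1 then (1 : L) else 0)).Local v)),
          MeasurableSpace (((cmDatum L 2 (Matrix.of fun i j : Fin 2 => if i.val + j.val + 1 = 2 then (1 : L) else 0)).Local v ×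
              (cmDatum L 1 (Matrix.of fun i j : Fin 1 => if i.val + j.val + 1 = 1 then (1 : L) else 0)).Local v) ⧸
            Subgroup.centralizer ({a} : Set ((cmDatum L 2 (Matrix.of fun i j : Fin 2 => if i.val + j.val + 1 = 2 then (1 : L) else 0)).Local v ×
              (cmDatum L 1 (Matrix.of fun i j : Fin 1 => if i.val + j.val + 1 = 1 then (1 : L) else 0)).Local v)))]
        [∀ (v : HeightOneSpectrum (𝓞 ↥(maximalRealSubfield L))) (γ : (cmDatum L 3 H).Local v),
          MeasurableSpace ((cmDatum L 3 H).Local v ⧸ Subgroup.centralizer ({γ} : Set ((cmDatum L 3 H).Local v)))]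
        (Δ : ∀ v : HeightOneSpectrum (𝓞 ↥(maximalRealSubfield L)), LocalTransferFactor L H v)
        (mH : ∀ v : HeightOneSpectrum (𝓞 ↥(maximalRealSubfield L)),
          OrbitalMeasureFamily ((cmDatum L 2 (Matrix.of fun i j : Fin 2 => if i.val + j.val + 1 = 2 then (1 : L) else 0)).Local v ×
            (cmDatum L 1 (Matrix.of fun i j : Fin 1 => if i.val + j.val + 1 = 1 then (1 : L) else 0)).Local v))
        (mG : ∀ v : HeightOneSpectrum (𝓞 ↥(maximalRealSubfield L)), OrbitalMeasureFamily ((cmDatum L 3 H).Local v))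
        (νG : ∀ v : HeightOneSpectrum (𝓞 ↥(maximalRealSubfield L)), Measure ((cmDatum L 3 H).Local v))
        (νH : ∀ v : HeightOneSpectrum (𝓞 ↥(maximalRealSubfield L)),
          Measure ((cmDatum L 2 (Matrix.of fun i j : Fin 2 => if i.val + j.val + 1 = 2 then (1 : L) else 0)).Local v ×
            (cmDatum L 1 (Matrix.of fun i j : Fin 1 => if i.val + j.val + 1 = 1 then (1 : L) else 0)).Local v))
        [∀ v : HeightOneSpectrum (𝓞 ↥(maximalRealSubfield L)), BorelSpace ((cmDatum L 3 H).Local v)]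
        [∀ v : HeightOneSpectrum (𝓞 ↥(maximalRealSubfield L)),
          BorelSpace ((cmDatum L 2 (Matrix.of fun i j : Fin 2 => if i.val + j.val + 1 = 2 then (1 : L) else 0)).Local v ×
            (cmDatum L 1 (Matrix.of fun i j : Fin 1 => if i.val + j.val + 1 = 1 then (1 : L) else 0)).Local v)]
        [∀ (v : HeightOneSpectrum (𝓞 ↥(maximalRealSubfield L)))
            (a : ((cmDatum L 2 (Matrix.of fun i j : Fin 2 => if i.val + j.val + 1 = 2 then (1 : L) else 0)).Local v ×
              (cmDatum L 1 (Matrix.of fun i j : Fin 1 => if i.val + j.val + 1 = 1 then (1 : L) else 0)).Local v)),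
          BorelSpace (((cmDatum L 2 (Matrix.of fun i j : Fin 2 => if i.val + j.val + 1 = 2 then (1 : L) else 0)).Local v ×
              (cmDatum L 1 (Matrix.of fun i j : Fin 1 => if i.val + j.val + 1 = 1 then (1 : L) else 0)).Local v) ⧸
            Subgroup.centralizer ({a} : Set ((cmDatum L 2 (Matrix.of fun i j : Fin 2 => if i.val + j.val + 1 = 2 then (1 : L) else 0)).Local v ×
              (cmDatum L 1 (Matrix.of fun i j : Fin 1 => if i.val + j.val + 1 = 1 then (1 : L) else 0)).Local v)))]
        [∀ (v : HeightOneSpectrum (𝓞 ↥(maximalRealSubfield L))) (γ : (cmDatum L 3 H).Local v),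
          BorelSpace ((cmDatum L 3 H).Local v ⧸ Subgroup.centralizer ({γ} : Set ((cmDatum L 3 H).Local v)))]
        [∀ v, (νG v).IsHaarMeasure] [∀ v, (νG v).IsMulRightInvariant] [∀ v, (νH v).IsHaarMeasure] [∀ v, (νH v).IsMulRightInvariant],
        ∀ (μω : HeckeCharacter L) (hμu : μω.IsUnitary),
        (∀ x : Literature.NumberTheory.GaloisRepresentations.ideleGroup ↥(maximalRealSubfield L),
          μω (AdeleRing.ideleBaseChange (↥(maximalRealSubfield L)) L x) = quadraticHeckeCharCM L x) →
        Δ = finExplicitCollection L H μω (finExplicitDelta_conj_left_all L H μω) (finExplicitDelta_conj_right_all L H μω) →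
        (∀ v : HeightOneSpectrum (𝓞 ↥(maximalRealSubfield L)), (mH v).IsCanonical (IsLocalGRegular L v) (νH v) ∧
          (mG v).IsCanonical (fun γ => IsRegularElt (γ.val : GL (Fin 3) (UnitaryGroup.LocalRing L v))) (νG v)) →
        CMCharIdentityPackageTestSigned L H hH hHd νH νG μω hμu Δ mH mG →
        (∀ v : HeightOneSpectrum (𝓞 ↥(maximalRealSubfield L)), (∀ w : PlacesOver L v, IsCMField.complexConj L • w.1 = w.1) →
          IsLocalDeltaTransferExists L H v (Δ v) (mH v) (mG v) Literature.NumberTheory.Rogawski1990.IsLocSmooth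
            Literature.NumberTheory.Rogawski1990.IsLocSmooth) →
        ∀ (ξ : OneDimAutRepH L)
          (μA : Measure (adelicGroupData (↥(maximalRealSubfield L)) L (IsCMField.complexConj L) 3 H).automorphicQuotient)
          [(adelicGroupData (↥(maximalRealSubfield L)) L (IsCMField.complexConj L) 3 H).IsAutomorphicMeasure μA]
          (P : DiscreteAutomorphicRep (adelicGroupData (↥(maximalRealSubfield L)) L (IsCMField.complexConj L) 3 H) μA),
          MemXiFamily P hH hHd μω hμu ξ →
          ∀ (v : HeightOneSpectrum (𝓞 ↥(maximalRealSubfield L))), (∀ w : PlacesOver L v, IsCMField.complexConj L • w.1 = w.1) →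
          ∀ (T : GL (Fin 3) (LocalRing L v)) (a : LocalRing L v) (ha : IsUnit a)
            (h : formCongr (conjLocal L (IsCMField.complexConj L) v) T (H.map (algebraMap L (LocalRing L v))) =
              a • (Matrix.of fun i j : Fin 3 => if i.val + j.val + 1 = 3 then (1 : L) else 0).map (algebraMap L (LocalRing L v))),
          ∀ [MeasurableSpace (Gqs L v ⧸ Subgroup.center (Gqs L v))] [BorelSpace (Gqs L v ⧸ Subgroup.center (Gqs L v))]
            (μZ : Measure (Gqs L v ⧸ Subgroup.center (Gqs L v))) [μZ.IsHaarMeasure],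
          ∀ (π2 πn : IrrClass (Gqs L v)),
            KeysCaseTwoLabels L v (μω.semilocalComponent L v) (torusLocalComponent L (IsCMField.complexConj L) v ξ.η)
              (torusLocalComponent L (IsCMField.complexConj L) v ξ.ψ) π2 πn →
            ¬ πn.IsSquareIntegrable μZ →
            -- (β) «every SUPERCUSPIDAL v-constituent of P completes πⁿ ∘ e in the SIGNED (13.1.4) on test functions»
            ∀ c : IrrClass ((cmDatum L 3 H).Local v),
              (IrrClass.comap (localPiEquiv L (IsCMField.complexConj L) 3 H v) c).IsConstituentOf
                  (P.finRep.smoothPart.toRepresentation.comp (inclPlace (↥(maximalRealSubfield L)) L (IsCMField.complexConj L) 3 H v)) →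
              c.IsSupercuspidal →
              (⟨IrrClass.comap (cmDatumLocalCongr L v T ha h).symm πn, some c⟩ : CMLocalAPacket L H v).CharIdentityAtTest L H v
              (fun c' f => (if ∃ z : LocalRing L v, IsUnit z ∧ a = z * conjLocal L (IsCMField.complexConj L) v z then (1 : ℂ) else -1) *
              c'.smoothTrace (νG v) f)
              (ξ.xiLocalChar v) (νH v) (Δ v) (mH v) (mG v)) :
    ∀ (L : Type) [Field L] [NumberField L] [IsCMField L] (H : Matrix (Fin 3) (Fin 3) L)
      (hH : (H.map (cmConjRingHom L))ᵀ = H) (hHd : IsUnit H.det)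
      [∀ v : HeightOneSpectrum (𝓞 ↥(maximalRealSubfield L)), MeasurableSpace ((cmDatum L 3 H).Local v)]
      [∀ v : HeightOneSpectrum (𝓞 ↥(maximalRealSubfield L)),
        MeasurableSpace ((cmDatum L 2 (Matrix.of fun i j : Fin 2 => if i.val + j.val + 1 = 2 then (1 : L) else 0)).Local v ×
          (cmDatum L 1 (Matrix.of fun i j : Fin 1 => if i.val + j.val + 1 = 1 then (1 : L) else 0)).Local v)]
      [∀ (v : HeightOneSpectrum (𝓞 ↥(maximalRealSubfield L)))
          (a : ((cmDatum L 2 (Matrix.of fun i j : Fin 2 => if i.val + j.val + 1 = 2 then (1 : L) else 0)).Local v ×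
            (cmDatum L 1 (Matrix.of fun i j : Fin 1 => if i.val + j.val + 1 = 1 then (1 : L) else 0)).Local v)),
        MeasurableSpace (((cmDatum L 2 (Matrix.of fun i j : Fin 2 => if i.val + j.val + 1 = 2 then (1 : L) else 0)).Local v ×
            (cmDatum L 1 (Matrix.of fun i j : Fin 1 => if i.val + j.val + 1 = 1 then (1 : L) else 0)).Local v) ⧸
          Subgroup.centralizer ({a} : Set ((cmDatum L 2 (Matrix.of fun i j : Fin 2 => if i.val + j.val + 1 = 2 then (1 : L) else 0)).Local v ×
            (cmDatum L 1 (Matrix.of fun i j : Fin 1 => if i.val + j.val + 1 = 1 then (1 : L) else 0)).Local v)))]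
      [∀ (v : HeightOneSpectrum (𝓞 ↥(maximalRealSubfield L))) (γ : (cmDatum L 3 H).Local v),
        MeasurableSpace ((cmDatum L 3 H).Local v ⧸ Subgroup.centralizer ({γ} : Set ((cmDatum L 3 H).Local v)))]
      (Δ : ∀ v : HeightOneSpectrum (𝓞 ↥(maximalRealSubfield L)), LocalTransferFactor L H v)
      (mH : ∀ v : HeightOneSpectrum (𝓞 ↥(maximalRealSubfield L)),
        OrbitalMeasureFamily ((cmDatum L 2 (Matrix.of fun i j : Fin 2 => if i.val + j.val + 1 = 2 then (1 : L) else 0)).Local v ×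
          (cmDatum L 1 (Matrix.of fun i j : Fin 1 => if i.val + j.val + 1 = 1 then (1 : L) else 0)).Local v))
      (mG : ∀ v : HeightOneSpectrum (𝓞 ↥(maximalRealSubfield L)), OrbitalMeasureFamily ((cmDatum L 3 H).Local v))
      (νG : ∀ v : HeightOneSpectrum (𝓞 ↥(maximalRealSubfield L)), Measure ((cmDatum L 3 H).Local v))
      (νH : ∀ v : HeightOneSpectrum (𝓞 ↥(maximalRealSubfield L)),
        Measure ((cmDatum L 2 (Matrix.of fun i j : Fin 2 => if i.val + j.val + 1 = 2 then (1 : L) else 0)).Local v ×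
          (cmDatum L 1 (Matrix.of fun i j : Fin 1 => if i.val + j.val + 1 = 1 then (1 : L) else 0)).Local v))
      [∀ v : HeightOneSpectrum (𝓞 ↥(maximalRealSubfield L)), BorelSpace ((cmDatum L 3 H).Local v)]
      [∀ v : HeightOneSpectrum (𝓞 ↥(maximalRealSubfield L)),
        BorelSpace ((cmDatum L 2 (Matrix.of fun i j : Fin 2 => if i.val + j.val + 1 = 2 then (1 : L) else 0)).Local v ×
          (cmDatum L 1 (Matrix.of fun i j : Fin 1 => if i.val + j.val + 1 = 1 then (1 : L) else 0)).Local v)]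
      [∀ (v : HeightOneSpectrum (𝓞 ↥(maximalRealSubfield L)))
          (a : ((cmDatum L 2 (Matrix.of fun i j : Fin 2 => if i.val + j.val + 1 = 2 then (1 : L) else 0)).Local v ×
            (cmDatum L 1 (Matrix.of fun i j : Fin 1 => if i.val + j.val + 1 = 1 then (1 : L) else 0)).Local v)),
        BorelSpace (((cmDatum L 2 (Matrix.of fun i j : Fin 2 => if i.val + j.val + 1 = 2 then (1 : L) else 0)).Local v ×
            (cmDatum L 1 (Matrix.of fun i j : Fin 1 => if i.val + j.val + 1 = 1 then (1 : L) else 0)).Local v) ⧸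
          Subgroup.centralizer ({a} : Set ((cmDatum L 2 (Matrix.of fun i j : Fin 2 => if i.val + j.val + 1 = 2 then (1 : L) else 0)).Local v ×
            (cmDatum L 1 (Matrix.of fun i j : Fin 1 => if i.val + j.val + 1 = 1 then (1 : L) else 0)).Local v)))]
      [∀ (v : HeightOneSpectrum (𝓞 ↥(maximalRealSubfield L))) (γ : (cmDatum L 3 H).Local v),
        BorelSpace ((cmDatum L 3 H).Local v ⧸ Subgroup.centralizer ({γ} : Set ((cmDatum L 3 H).Local v)))]
      [∀ v, (νG v).IsHaarMeasure] [∀ v, (νG v).IsMulRightInvariant] [∀ v, (νH v).IsHaarMeasure] [∀ v, (νH v).IsMulRightInvariant],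
      ∀ (μω : HeckeCharacter L) (hμu : μω.IsUnitary),
      (∀ x : Literature.NumberTheory.GaloisRepresentations.ideleGroup ↥(maximalRealSubfield L),
        μω (AdeleRing.ideleBaseChange (↥(maximalRealSubfield L)) L x) = quadraticHeckeCharCM L x) →
      Δ = finExplicitCollection L H μω (finExplicitDelta_conj_left_all L H μω) (finExplicitDelta_conj_right_all L H μω) →
      (∀ v : HeightOneSpectrum (𝓞 ↥(maximalRealSubfield L)), (mH v).IsCanonical (IsLocalGRegular L v) (νH v) ∧
        (mG v).IsCanonical (fun γ => IsRegularElt (γ.val : GL (Fin 3) (UnitaryGroup.LocalRing L v))) (νG v)) →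
      ∀ (hQS : CMCharIdentityPackageTestSigned L H hH hHd νH νG μω hμu Δ mH mG),
      (∀ v : HeightOneSpectrum (𝓞 ↥(maximalRealSubfield L)), (∀ w : PlacesOver L v, IsCMField.complexConj L • w.1 = w.1) →
        IsLocalDeltaTransferExists L H v (Δ v) (mH v) (mG v) Literature.NumberTheory.Rogawski1990.IsLocSmooth
          Literature.NumberTheory.Rogawski1990.IsLocSmooth) →
      ∀ (ξ : OneDimAutRepH L)
        (μA : Measure (adelicGroupData (↥(maximalRealSubfield L)) L (IsCMField.complexConj L) 3 H).automorphicQuotient)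
        [(adelicGroupData (↥(maximalRealSubfield L)) L (IsCMField.complexConj L) 3 H).IsAutomorphicMeasure μA]
        (P : DiscreteAutomorphicRep (adelicGroupData (↥(maximalRealSubfield L)) L (IsCMField.complexConj L) 3 H) μA),
        MemXiFamily P hH hHd μω hμu ξ →
        ∀ (v : HeightOneSpectrum (𝓞 ↥(maximalRealSubfield L))) (hns : ∀ w : PlacesOver L v, IsCMField.complexConj L • w.1 = w.1),
        ∀ (T : GL (Fin 3) (LocalRing L v)) (a : LocalRing L v) (ha : IsUnit a)
          (h : formCongr (conjLocal L (IsCMField.complexConj L) v) T (H.map (algebraMap L (LocalRing L v))) =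
            a • (Matrix.of fun i j : Fin 3 => if i.val + j.val + 1 = 3 then (1 : L) else 0).map (algebraMap L (LocalRing L v))),
        ∀ [MeasurableSpace (Gqs L v ⧸ Subgroup.center (Gqs L v))] [BorelSpace (Gqs L v ⧸ Subgroup.center (Gqs L v))]
          (μZ : Measure (Gqs L v ⧸ Subgroup.center (Gqs L v))) [μZ.IsHaarMeasure],
        ∀ (π2 πn : IrrClass (Gqs L v)),
        ∀ (hK : KeysCaseTwoLabels L v (μω.semilocalComponent L v) (torusLocalComponent L (IsCMField.complexConj L) v ξ.η)
            (torusLocalComponent L (IsCMField.complexConj L) v ξ.ψ) π2 πn)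
          (hn : ¬ πn.IsSquareIntegrable μZ),
          -- (S-U) «SC-UNIQUE»: every SUPERCUSPIDAL v-constituent of P IS the πˢ(ξ_v) ∘ e read off the SIGNED Q-package `hQS`
          ∀ c : IrrClass ((cmDatum L 3 H).Local v),
            (IrrClass.comap (localPiEquiv L (IsCMField.complexConj L) 3 H v) c).IsConstituentOf
                (P.finRep.smoothPart.toRepresentation.comp (inclPlace (↥(maximalRealSubfield L)) L (IsCMField.complexConj L) 3 H v)) →
            c.IsSupercuspidal →
            c = ((hQS ξ).1 v hns T a ha h μZ π2 πn hK hn).πs := by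
  intro L _ _ _ H hH hHd _ _ _ _ Δ mH mG νG νH _ _ _ _ _ _ _ _ μω hμu hμω hΔ hcan hQS hex ξ μA _ P hmem v hns T a ha h _ _ μZ _ π2 πn hK hn c hc hsc
  exact eq_of_charIdentityAtTestSigned L H v hH hHd (hex v hns) (νG v) (by split_ifs <;> norm_num)
    (Hβ L H hH hHd Δ mH mG νG νH μω hμu hμω hΔ hcan hQS hex ξ μA P hmem v hns T a ha h μZ π2 πn hK hn c hc hsc)
    ((hQS ξ).1 v hns T a ha h μZ π2 πn hK hn).charIdentityAtTestSigned_πs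

end Summit.HodgeConjecture.HodgeConjecture.R90.S5

end
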